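import Literature.MathematicalPhysics.QuantumLattice.HubbardSectorPropagatorGram
import Literature.MathematicalPhysics.QuantumLattice.NambuPropagatorMatsubaraLimit
import HarnessLib

/-!
# The vertex-field substitution of the Hubbard torus: position–time fields at real times and their covariance

Topic `MathematicalPhysics/QuantumLattice`; the Grassmann-side first step of the `M → ∞` ("Matsubara UV") bridge
between the finite-frequency Grassmann representation (`HubbardFreeCovariance`, `HubbardEffectiveAction`) and
Hamiltonian traces (`ShiftedHubbardDysonDeterminant`).  The interaction vertices of the perturbation expansion sit
at space–time points `(x⃗_a, τ_a)`, `τ_a ∈ [0, β]` REAL (BGM 2006, (2.6a): `∫dx = ∫dx₀ Σ_x⃗`); the fields there are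
BGM's `ψ^±_{x,σ} = (βL²)⁻¹ Σ_k e^{±ik·x} ψ̂^±_{k,σ}` ((2.5)) with `k·x = ω τ + p_k⃗·x⃗`.  As in the sector-field file
(`HubbardSectorFieldSubstitution`, same phase and charge-sign conventions, but a REAL time instead of a point of
the dual time lattice) they are realised by a substitution matrix:

* `VertexLeg n = (Fin n × Fin 2) × Fin 2` — (vertex, spin), charge; `vertexPhase`, `vertexPlaneWave`
  (`e^{-i s_c (ωτ + p·x⃗)}`), **`vertexSubMatrix β x τ`** `: Matrix (HubbardFieldIdx L M) (VertexLeg n) ℂ`,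
  `map (toLin' S) (gen ((a,σ),c)) = (βL²)⁻¹ Σ_k conj(e^{-is_c k·x_a}) ψ̂^c_{k,σ}` (`map_vertexSub_gen`);
* `vertexSub_pullback_apply` — `Sᵀ C S` for any momentum-space covariance `C`;
* **`vertexSub_pullback_zero_seed_apply_zero_one`** — for the zero-seed free covariance
  (`hubbardCovariance_zero_seed`, symbol `βL²/(-iω + ξ)`):
  `(Sᵀ C S)((a,σ,+),(b,σ',−)) = [σ = σ'] (1/L²) Σ_k⃗ e^{ip·(x⃗_a − x⃗_b)} · (1/β) Σᵢ e^{-iωᵢ(τ_b − τ_a)}/(-iωᵢ + ξ_k⃗)`,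
  the TRUNCATED position–time propagator `g_M(x_b − x_a)` of BGM (2.3)–(2.4); the `(−,+)` entry is minus the transposed
  one (`…_apply_one_zero`), equal charges (`…_of_charge_eq`) and unequal spins give `0`;
* `tendsto_vertexSub_pullback_zero_seed_zero_one(_neg)`, `norm_vertexSub_pullback_zero_seed_zero_one_le` — by
  `MatsubaraTruncationConvergence`, as `M → ∞` these entries converge boundedly to the free imaginary-time propagator
  `(1/L²) Σ_k⃗ e^{ip·(x⃗_a−x⃗_b)} (1 − n_F(ξ_k⃗)) e^{-ξ(τ_b−τ_a)}` (`0 < τ_b − τ_a < β`), resp.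
  `-(1/L²) Σ_k⃗ e^{ip·(x⃗_a−x⃗_b)} n_F(ξ_k⃗) e^{-ξ(τ_b−τ_a)}` (`-β < τ_b − τ_a < 0`).

With `GrassmannLinearSubstitution.gaussConv_map` (`∫dμ_C (F∘S) = ∫dμ_{SᵀCS} F`) and the determinant Wick rule
(`gaussExpect_genPairProd`) this turns Gaussian expectations of products of interaction vertices into determinants of
truncated propagators, whose `M → ∞` limit is then `Literature.Analysis.Matrix.tendsto_integral_cube_det`; those
steps are NOT taken here.  Everything below is proved; the definitions are the phase, the plane wave and the matrix.

## Sources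

G. Benfatto, A. Giuliani, V. Mastropietro, Ann. Henri Poincaré 7 (2006) 809–898 = arXiv:cond-mat/0507686, §2.1
(2.2)–(2.6a) [`BenfattoGiulianiMastropietro2006`]; M. Salmhofer, *Renormalization* (1999), App. B.2 (B.23)–(B.25)
[`Salmhofer1999`].
-/

noncomputable section

namespace Literature.MathematicalPhysics.QuantumLattice

open GrassmannAlgebra Finset Filter Literature.Probability.LatticeModels _root_.Topology
open scoped ComplexConjugate

/-! ### Vertex legs, phases, plane waves -/

/-- The **legs of `n` interaction vertices**: `((a, σ), c)` = (vertex `a < n`, spin `σ`, charge `c`, `0 ↦ ψ⁺`,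
`1 ↦ ψ⁻`), mirroring `HubbardFieldIdx = ((k, σ), c)`. [cite: BenfattoGiulianiMastropietro2006, §2.1 (2.6a)] -/
abbrev VertexLeg (n : ℕ) : Type := (Fin n × Fin 2) × Fin 2

variable (L M : ℕ)

/-- The **phase** `k·x = ω τ + p_k⃗·x⃗` of the frequency–momentum `k = (ω, k⃗)` at the space–time point `(x⃗, τ)`
with REAL time `τ` (`p_k⃗ = 2πk⃗/L`, `x⃗` through its representatives in `[0, L)`; cf. `spaceTimePhase` on the
dual time lattice). [cite: BenfattoGiulianiMastropietro2006, §2.1 (2.5)] -/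
def vertexPhase (β : ℝ) (k : FreqMomentum L M) (x : TorusSite 2 L) (τ : ℝ) : ℝ :=
  matsubaraFreq β M k.1 * τ + ∑ i, latticeMomentum L k.2 i * ((x i).val : ℝ)

/-- The **plane wave** `e^{-i s_c k·x}` of the field `ψ̂^c_k` at `(x⃗, τ)` (`s_c = chargeSign c`), the kernel
inverse to BGM's `ψ^±_x = (βL²)⁻¹ Σ_k e^{±ik·x} ψ̂^±_k`. [cite: BenfattoGiulianiMastropietro2006, §2.1 (2.5)] -/
def vertexPlaneWave (β : ℝ) (c : Fin 2) (k : FreqMomentum L M) (x : TorusSite 2 L) (τ : ℝ) : ℂ :=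
  Complex.exp (-((chargeSign c * vertexPhase L M β k x τ : ℝ) : ℂ) * Complex.I)

/-- **The vertex-field substitution matrix**: the generator of leg `((a,σ),c)` of `n` vertices at `(x⃗_a, τ_a)` is
the position–time field `ψ^c_{(x⃗_a,τ_a),σ} = (βL²)⁻¹ Σ_k conj(e^{-is_c k·x_a}) ψ̂^c_{k,σ}` (BGM 2006, (2.5)).
[cite: BenfattoGiulianiMastropietro2006, §2.1 (2.5)] -/
def vertexSubMatrix (β : ℝ) {n : ℕ} (x : Fin n → TorusSite 2 L) (τ : Fin n → ℝ) :
    Matrix (HubbardFieldIdx L M) (VertexLeg n) ℂ :=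
  Matrix.of fun K Y => if K.1.2 = Y.1.2 ∧ K.2 = Y.2 then
    ((1 / (β * (L : ℝ) ^ 2) : ℝ) : ℂ) * conj (vertexPlaneWave L M β Y.2 K.1.1 (x Y.1.1) (τ Y.1.1)) else 0

variable {L M}

/-- Unfolding `vertexSubMatrix`. [folklore] -/
theorem vertexSubMatrix_apply (β : ℝ) {n : ℕ} (x : Fin n → TorusSite 2 L) (τ : Fin n → ℝ)
    (K : HubbardFieldIdx L M) (Y : VertexLeg n) :
    vertexSubMatrix L M β x τ K Y = if K.1.2 = Y.1.2 ∧ K.2 = Y.2 then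
      ((1 / (β * (L : ℝ) ^ 2) : ℝ) : ℂ) * conj (vertexPlaneWave L M β Y.2 K.1.1 (x Y.1.1) (τ Y.1.1)) else 0 := rfl

/-- Plane waves are unimodular. [folklore] -/
theorem norm_vertexPlaneWave (β : ℝ) (c : Fin 2) (k : FreqMomentum L M) (x : TorusSite 2 L) (τ : ℝ) :
    ‖vertexPlaneWave L M β c k x τ‖ = 1 := by
  rw [vertexPlaneWave, ← Complex.ofReal_neg, Complex.norm_exp_ofReal_mul_I]

/-- `conj(e^{-is_c φ}) = e^{is_c φ}`. [folklore] -/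
theorem conj_vertexPlaneWave (β : ℝ) (c : Fin 2) (k : FreqMomentum L M) (x : TorusSite 2 L) (τ : ℝ) :
    conj (vertexPlaneWave L M β c k x τ) = Complex.exp (((chargeSign c * vertexPhase L M β k x τ : ℝ) : ℂ) * Complex.I) := by
  rw [vertexPlaneWave, ← Complex.exp_conj, map_mul, Complex.conj_I, map_neg, Complex.conj_ofReal]
  ring_nf

/-- The `ψ⁺` leg carries `e^{+iφ}` and the `ψ⁻` leg `e^{-iφ}`: `conj(e^{-is_0 φ}) conj(e^{-is_1 φ'}) = e^{i(φ − φ')}`.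
[folklore] -/
theorem conj_vertexPlaneWave_zero_mul_one (β : ℝ) (k : FreqMomentum L M) (x y : TorusSite 2 L) (τ τ' : ℝ) :
    conj (vertexPlaneWave L M β 0 k x τ) * conj (vertexPlaneWave L M β 1 k y τ') =
      Complex.exp (((vertexPhase L M β k x τ - vertexPhase L M β k y τ' : ℝ) : ℂ) * Complex.I) := by
  rw [conj_vertexPlaneWave, conj_vertexPlaneWave, ← Complex.exp_add]
  congr 1
  simp only [chargeSign, if_true, show (1 : Fin 2) ≠ 0 from by decide, if_false]
  push_cast
  ring

/-! ### The substitution realises the position–time fields; the pulled-back covariance -/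

section Pullback

variable [NeZero L]

/-- **The substitution realises BGM's position–time fields**:
`map (toLin' S) (gen ((a,σ),c)) = Σ_k (βL²)⁻¹ conj(e^{-is_c k·x_a}) • ψ̂^c_{k,σ}`. [cite: BenfattoGiulianiMastropietro2006, §2.1 (2.5)] -/
theorem map_vertexSub_gen (β : ℝ) {n : ℕ} (x : Fin n → TorusSite 2 L) (τ : Fin n → ℝ) (Y : VertexLeg n) :
    ExteriorAlgebra.map (Matrix.toLin' (vertexSubMatrix L M β x τ)) (gen ℂ Y) =
      ∑ k : FreqMomentum L M, ((((1 / (β * (L : ℝ) ^ 2) : ℝ) : ℂ) *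
        conj (vertexPlaneWave L M β Y.2 k (x Y.1.1) (τ Y.1.1))) • gen ℂ (((k, Y.1.2), Y.2) : HubbardFieldIdx L M)) := by
  rw [map_gen_eq_sum, LinearMap.toMatrix'_toLin']
  simp only [vertexSubMatrix_apply, ite_smul, zero_smul, sum_fieldIdx_ite]

/-- **The pulled-back covariance of the vertex fields** for an arbitrary momentum-space covariance `C`:
`(Sᵀ C S)(Y, Y') = Σ_{k,k'} a_Y(k) C(((k,σ),c),((k',σ'),c')) a_{Y'}(k')`, `a_Y(k) = (βL²)⁻¹ conj(e^{-is_c k·x_a})`.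
[cite: Salmhofer1999, App. B.2 (B.23)-(B.25)] -/
theorem vertexSub_pullback_apply (β : ℝ) {n : ℕ} (x : Fin n → TorusSite 2 L) (τ : Fin n → ℝ)
    (C : Matrix (HubbardFieldIdx L M) (HubbardFieldIdx L M) ℂ) (Y Y' : VertexLeg n) :
    ((vertexSubMatrix L M β x τ).transpose * C * vertexSubMatrix L M β x τ) Y Y' =
      ∑ k : FreqMomentum L M, ∑ k' : FreqMomentum L M,
        (((1 / (β * (L : ℝ) ^ 2) : ℝ) : ℂ) * conj (vertexPlaneWave L M β Y.2 k (x Y.1.1) (τ Y.1.1))) *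
          C ((k, Y.1.2), Y.2) ((k', Y'.1.2), Y'.2) *
        (((1 / (β * (L : ℝ) ^ 2) : ℝ) : ℂ) * conj (vertexPlaneWave L M β Y'.2 k' (x Y'.1.1) (τ Y'.1.1))) := by
  rw [Matrix.mul_apply]
  have h1 : ∀ K' : HubbardFieldIdx L M, ((vertexSubMatrix L M β x τ).transpose * C) Y K' * vertexSubMatrix L M β x τ K' Y' =
      if K'.1.2 = Y'.1.2 ∧ K'.2 = Y'.2 then ((vertexSubMatrix L M β x τ).transpose * C) Y K' *
        (((1 / (β * (L : ℝ) ^ 2) : ℝ) : ℂ) * conj (vertexPlaneWave L M β Y'.2 K'.1.1 (x Y'.1.1) (τ Y'.1.1)))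
        else 0 := by
    intro K'
    rw [vertexSubMatrix_apply]
    split_ifs <;> simp
  simp_rw [h1]
  rw [sum_fieldIdx_ite, sum_comm]
  refine sum_congr rfl fun k' _ => ?_
  rw [Matrix.mul_apply]
  have h2 : ∀ K : HubbardFieldIdx L M, (vertexSubMatrix L M β x τ).transpose Y K * C K ((k', Y'.1.2), Y'.2) =
      if K.1.2 = Y.1.2 ∧ K.2 = Y.2 then
        (((1 / (β * (L : ℝ) ^ 2) : ℝ) : ℂ) * conj (vertexPlaneWave L M β Y.2 K.1.1 (x Y.1.1) (τ Y.1.1))) *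
          C K ((k', Y'.1.2), Y'.2) else 0 := by
    intro K
    rw [Matrix.transpose_apply, vertexSubMatrix_apply]
    split_ifs <;> simp
  simp_rw [h2]
  rw [sum_fieldIdx_ite, sum_mul]

/-- **Normal covariances pull back to normal-ordered propagators, `(+, −)` entry**: for `C = normalCovariance p`,
`(Sᵀ C S)((a,σ,+),(b,σ',−)) = [σ = σ'] (βL²)⁻² Σ_k e^{i(k·x_a − k·x_b)} p(k,σ)`. [folklore] -/
theorem vertexSub_pullback_normalCovariance_apply_zero_one (β : ℝ) {n : ℕ} (x : Fin n → TorusSite 2 L)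
    (τ : Fin n → ℝ) (p : FreqMomentum L M × Fin 2 → ℂ) (a b : Fin n) (σ σ' : Fin 2) :
    ((vertexSubMatrix L M β x τ).transpose * normalCovariance L M p * vertexSubMatrix L M β x τ)
        ((a, σ), 0) ((b, σ'), 1) =
      if σ = σ' then ∑ k : FreqMomentum L M, ((1 / (β * (L : ℝ) ^ 2) : ℝ) : ℂ) ^ 2 *
        (Complex.exp (((vertexPhase L M β k (x a) (τ a) - vertexPhase L M β k (x b) (τ b) : ℝ) : ℂ) * Complex.I) *
          p (k, σ)) else 0 := by
  rw [vertexSub_pullback_apply]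
  by_cases hσ : σ = σ'
  · subst hσ
    simp only [normalCovariance_apply, Prod.mk.injEq, and_true, Fin.isValue, and_self, if_true, mul_ite, ite_mul,
      mul_zero, zero_mul, Finset.sum_ite_eq, Finset.mem_univ]
    refine sum_congr rfl fun k _ => ?_
    calc ((1 / (β * (L : ℝ) ^ 2) : ℝ) : ℂ) * conj (vertexPlaneWave L M β 0 k (x a) (τ a)) * p (k, σ) *
          (((1 / (β * (L : ℝ) ^ 2) : ℝ) : ℂ) * conj (vertexPlaneWave L M β 1 k (x b) (τ b)))
        = ((1 / (β * (L : ℝ) ^ 2) : ℝ) : ℂ) ^ 2 * ((conj (vertexPlaneWave L M β 0 k (x a) (τ a)) *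
            conj (vertexPlaneWave L M β 1 k (x b) (τ b))) * p (k, σ)) := by ring
      _ = _ := by rw [conj_vertexPlaneWave_zero_mul_one]
  · rw [if_neg hσ]
    refine sum_eq_zero fun k _ => sum_eq_zero fun k' _ => ?_
    rw [normalCovariance_apply, if_neg (fun h => hσ (Prod.mk.inj h).2), mul_zero, zero_mul]

/-- **The `(−, +)` entry is minus the transposed `(+, −)` entry** (antisymmetry of `Sᵀ C S` for the antisymmetric
normal covariance). [folklore] -/
theorem vertexSub_pullback_normalCovariance_apply_one_zero (β : ℝ) {n : ℕ} (x : Fin n → TorusSite 2 L)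
    (τ : Fin n → ℝ) (p : FreqMomentum L M × Fin 2 → ℂ) (a b : Fin n) (σ σ' : Fin 2) :
    ((vertexSubMatrix L M β x τ).transpose * normalCovariance L M p * vertexSubMatrix L M β x τ)
        ((a, σ), 1) ((b, σ'), 0) =
      -((vertexSubMatrix L M β x τ).transpose * normalCovariance L M p * vertexSubMatrix L M β x τ)
        ((b, σ'), 0) ((a, σ), 1) := by
  set S := vertexSubMatrix L M β x τ
  have hT : (S.transpose * normalCovariance L M p * S).transpose = -(S.transpose * normalCovariance L M p * S) := by
    rw [Matrix.transpose_mul, Matrix.transpose_mul, Matrix.transpose_transpose, normalCovariance_transpose,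
      Matrix.neg_mul, Matrix.mul_neg, Matrix.mul_assoc]
  have h := congrFun (congrFun hT ((b, σ'), 0)) ((a, σ), 1)
  rw [Matrix.transpose_apply, Matrix.neg_apply] at h
  exact h

/-- **Equal charges do not contract**: `(Sᵀ C S)((a,σ,c),(b,σ',c)) = 0` for a normal covariance. [folklore] -/
theorem vertexSub_pullback_normalCovariance_apply_of_charge_eq (β : ℝ) {n : ℕ} (x : Fin n → TorusSite 2 L)
    (τ : Fin n → ℝ) (p : FreqMomentum L M × Fin 2 → ℂ) {Y Y' : VertexLeg n} (h : Y.2 = Y'.2) :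
    ((vertexSubMatrix L M β x τ).transpose * normalCovariance L M p * vertexSubMatrix L M β x τ) Y Y' = 0 := by
  rw [vertexSub_pullback_apply]
  refine sum_eq_zero fun k _ => sum_eq_zero fun k' _ => ?_
  have h0 : normalCovariance L M p ((k, Y.1.2), Y.2) ((k', Y'.1.2), Y'.2) = 0 :=
    normalCovariance_apply_of_charge_eq p (X := ((k, Y.1.2), Y.2)) (Y := ((k', Y'.1.2), Y'.2)) h
  rw [h0, mul_zero, zero_mul]

/-! ### The zero-seed Hubbard covariance: truncated position–time propagators and their `M → ∞` limit -/

omit [NeZero L] in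
/-- The zero-seed symbol is BGM's `ĝ(k) = 1/(-iω + ξ)`: `(iω + ξ)/(ω² + ξ²) = 1/(-iω + ξ)` (`β ≠ 0`). [cite: BenfattoGiulianiMastropietro2006, §2.1 (2.3)] -/
theorem symbol_zero_seed {β : ℝ} (hβ : β ≠ 0) (μ : ℝ) (k : FreqMomentum L M) :
    (Complex.I * matsubaraFreq β M k.1 + nambuXi L μ k.2) / nambuDen L M β μ 0 k =
      1 / (-(Complex.I * matsubaraFreq β M k.1) + nambuXi L μ k.2) := by
  rw [← (nambuPropagator_apply β μ 0 k).1, nambuPropagator_zero_seed (L := L) (M := M) hβ μ k, neg_mul]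

omit [NeZero L] in
/-- The phase difference of a `ψ⁺` leg at `(x⃗_a, τ_a)` and a `ψ⁻` leg at `(x⃗_b, τ_b)` splits into time and space:
`e^{i(k·x_a − k·x_b)} = e^{-iω(τ_b − τ_a)} e^{i p·(x⃗_a − x⃗_b)}`. [folklore] -/
theorem exp_vertexPhase_sub (β : ℝ) (k : FreqMomentum L M) (xa xb : TorusSite 2 L) (τa τb : ℝ) :
    Complex.exp (((vertexPhase L M β k xa τa - vertexPhase L M β k xb τb : ℝ) : ℂ) * Complex.I) =
      Complex.exp (-(Complex.I * matsubaraFreq β M k.1 * ((τb - τa : ℝ) : ℂ))) *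
        Complex.exp (((∑ j, latticeMomentum L k.2 j * (((xa j).val : ℝ) - ((xb j).val : ℝ)) : ℝ) : ℂ) * Complex.I) := by
  rw [← Complex.exp_add]
  congr 1
  simp only [vertexPhase]
  push_cast
  simp only [mul_sub, Finset.sum_sub_distrib]
  ring

/-- **The vertex fields of the zero-seed Hubbard torus contract through the TRUNCATED position–time propagator**:
`(Sᵀ C_M S)((a,σ,+),(b,σ',−)) = [σ = σ'] (1/L²) Σ_k⃗ e^{ip·(x⃗_a−x⃗_b)} · (1/β) Σᵢ e^{-iωᵢ(τ_b−τ_a)}/(-iωᵢ + ξ_k⃗)`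
(`= g_M(x_b − x_a)`, BGM 2006, (2.3)–(2.4) at cutoff `M`; `β ≠ 0`). [cite: BenfattoGiulianiMastropietro2006, §2.1 (2.3)-(2.4)] -/
theorem vertexSub_pullback_zero_seed_apply_zero_one {β : ℝ} (hβ : β ≠ 0) (μ : ℝ) {n : ℕ} (x : Fin n → TorusSite 2 L)
    (τ : Fin n → ℝ) (a b : Fin n) (σ σ' : Fin 2) :
    ((vertexSubMatrix L M β x τ).transpose * hubbardCovariance L M β μ 0 * vertexSubMatrix L M β x τ)
        ((a, σ), 0) ((b, σ'), 1) =
      if σ = σ' then ((1 / (L : ℝ) ^ 2 : ℝ) : ℂ) * ∑ q : TorusSite 2 L,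
        Complex.exp (((∑ j, latticeMomentum L q j * (((x a j).val : ℝ) - ((x b j).val : ℝ)) : ℝ) : ℂ) * Complex.I) *
          ((1 / (β : ℂ)) * ∑ i : MatsubaraIdx M, Complex.exp (-(Complex.I * matsubaraFreq β M i * ((τ b - τ a : ℝ) : ℂ))) *
            (1 / (-(Complex.I * matsubaraFreq β M i) + nambuXi L μ q)))
        else 0 := by
  rw [hubbardCovariance_zero_seed, vertexSub_pullback_normalCovariance_apply_zero_one]
  split_ifs with hσ
  · have hL : ((L : ℝ) : ℂ) ≠ 0 := by exact_mod_cast (NeZero.ne L)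
    have hβ' : (β : ℂ) ≠ 0 := by exact_mod_cast hβ
    rw [Fintype.sum_prod_type, Finset.sum_comm, Finset.mul_sum]
    refine sum_congr rfl fun q _ => ?_
    rw [Finset.mul_sum, Finset.mul_sum, Finset.mul_sum]
    refine sum_congr rfl fun i _ => ?_
    rw [symbol_zero_seed hβ μ (i, q), exp_vertexPhase_sub]
    push_cast
    field_simp
  · rfl

/-- **`M → ∞` limit of the vertex contraction, `0 < τ_b − τ_a < β`**: the truncated propagator between a `ψ⁺` leg at
`(x⃗_a, τ_a)` and a `ψ⁻` leg at `(x⃗_b, τ_b)` converges to the free imaginary-time propagator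
`[σ = σ'] (1/L²) Σ_k⃗ e^{ip·(x⃗_a−x⃗_b)} (1 + e^{-βξ_k⃗})⁻¹ e^{-ξ_k⃗(τ_b−τ_a)}` (`= ⟨a⁻_{x_b}(τ_b) a⁺_{x_a}(τ_a)⟩₀`).
[cite: BenfattoGiulianiMastropietro2006, §2.1 (2.3)-(2.4)] -/
theorem tendsto_vertexSub_pullback_zero_seed_zero_one {β : ℝ} (hβ : 0 < β) (μ : ℝ) {n : ℕ} (x : Fin n → TorusSite 2 L)
    (τ : Fin n → ℝ) (a b : Fin n) (σ σ' : Fin 2) (hτ : τ b - τ a ∈ Set.Ioo 0 β) :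
    Tendsto (fun M : ℕ => ((vertexSubMatrix L M β x τ).transpose * hubbardCovariance L M β μ 0 *
        vertexSubMatrix L M β x τ) ((a, σ), 0) ((b, σ'), 1)) atTop
      (𝓝 (if σ = σ' then ((1 / (L : ℝ) ^ 2 : ℝ) : ℂ) * ∑ q : TorusSite 2 L,
        Complex.exp (((∑ j, latticeMomentum L q j * (((x a j).val : ℝ) - ((x b j).val : ℝ)) : ℝ) : ℂ) * Complex.I) *
          ((((1 + Real.exp (-(β * nambuXi L μ q)))⁻¹ * Real.exp (-(nambuXi L μ q * (τ b - τ a)))) : ℝ) : ℂ)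
        else 0)) := by
  simp only [vertexSub_pullback_zero_seed_apply_zero_one hβ.ne']
  split_ifs with hσ
  · exact (tendsto_finsetSum _ fun q _ =>
      (tendsto_truncatedPropagator_bgm_of_mem_Ioo hβ (nambuXi L μ q) hτ).const_mul _).const_mul _
  · exact tendsto_const_nhds

/-- **`M → ∞` limit of the vertex contraction, `-β < τ_b − τ_a < 0`**: the limit is
`-[σ = σ'] (1/L²) Σ_k⃗ e^{ip·(x⃗_a−x⃗_b)} (1 + e^{βξ_k⃗})⁻¹ e^{-ξ_k⃗(τ_b−τ_a)}` (`= -⟨a⁺_{x_a}(τ_a) a⁻_{x_b}(τ_b)⟩₀`, the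
fermionic time-ordering sign). [cite: BenfattoGiulianiMastropietro2006, §2.1 (2.3)-(2.4)] -/
theorem tendsto_vertexSub_pullback_zero_seed_zero_one_neg {β : ℝ} (hβ : 0 < β) (μ : ℝ) {n : ℕ}
    (x : Fin n → TorusSite 2 L) (τ : Fin n → ℝ) (a b : Fin n) (σ σ' : Fin 2) (hτ : τ b - τ a ∈ Set.Ioo (-β) 0) :
    Tendsto (fun M : ℕ => ((vertexSubMatrix L M β x τ).transpose * hubbardCovariance L M β μ 0 *
        vertexSubMatrix L M β x τ) ((a, σ), 0) ((b, σ'), 1)) atTop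
      (𝓝 (if σ = σ' then ((1 / (L : ℝ) ^ 2 : ℝ) : ℂ) * ∑ q : TorusSite 2 L,
        Complex.exp (((∑ j, latticeMomentum L q j * (((x a j).val : ℝ) - ((x b j).val : ℝ)) : ℝ) : ℂ) * Complex.I) *
          (((-((1 + Real.exp (β * nambuXi L μ q))⁻¹ * Real.exp (-(nambuXi L μ q * (τ b - τ a))))) : ℝ) : ℂ)
        else 0)) := by
  simp only [vertexSub_pullback_zero_seed_apply_zero_one hβ.ne']
  split_ifs with hσ
  · exact (tendsto_finsetSum _ fun q _ =>
      (tendsto_truncatedPropagator_bgm_of_mem_Ioo_neg hβ (nambuXi L μ q) hτ).const_mul _).const_mul _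
  · exact tendsto_const_nhds

/-- **Uniform bound on the vertex contraction**: `‖(Sᵀ C_M S)((a,σ,+),(b,σ',−))‖ ≤ (1/L²) Σ_k⃗ (2 + β|ξ_k⃗|/3)` for every
`M` and all times (`β > 0`). [folklore] -/
theorem norm_vertexSub_pullback_zero_seed_zero_one_le {β : ℝ} (hβ : 0 < β) (μ : ℝ) {n : ℕ} (x : Fin n → TorusSite 2 L)
    (τ : Fin n → ℝ) (a b : Fin n) (σ σ' : Fin 2) (M : ℕ) :
    ‖((vertexSubMatrix L M β x τ).transpose * hubbardCovariance L M β μ 0 * vertexSubMatrix L M β x τ)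
        ((a, σ), 0) ((b, σ'), 1)‖ ≤ (1 / (L : ℝ) ^ 2) * ∑ q : TorusSite 2 L, (2 + β * |nambuXi L μ q| / 3) := by
  rw [vertexSub_pullback_zero_seed_apply_zero_one hβ.ne']
  have hnonneg : 0 ≤ (1 / (L : ℝ) ^ 2) * ∑ q : TorusSite 2 L, (2 + β * |nambuXi L μ q| / 3) := by positivity
  split_ifs with hσ
  · rw [norm_mul, Complex.norm_real, Real.norm_of_nonneg (by positivity)]
    refine mul_le_mul_of_nonneg_left ((norm_sum_le _ _).trans (sum_le_sum fun q _ => ?_)) (by positivity)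
    rw [norm_mul, Complex.norm_exp_ofReal_mul_I, one_mul]
    exact norm_truncatedPropagator_bgm_le hβ (nambuXi L μ q) (τ b - τ a) M
  · rw [norm_zero]; exact hnonneg

end Pullback

end Literature.MathematicalPhysics.QuantumLattice
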